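/-
Copyright (c) 2026 the pub-hodgecm-mathlib formalisation cell (harness21).  Prover seat hodgecm-mathlib-LH10-p01 (g10): road «M6 ∕ F3 TOT-Λ BY OVER-ORDERS»
(LEAD T14-66; SIG-F3-5 v1 6925585c (S7) «reindex», carve (c12)), 2026-09-03: the hermitian character classes modulo `ϖ^b` of `𝒪_E` are the classes of `𝒪_F` — the
bridge from the strata count of ★ F3-2b ∕ (c3) (classes `c′ mod ϖ^b` in `𝒪_E`) to ★ (S7b) `GluedOverOrdersCountLaw`'s `levelChars` (classes `y mod ϖ_F^b` in `𝒪_F`).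
-/
import Literature.NumberTheory.Automorphic.GluedOverOrderLevelFromPrincipal   -- ★ (ii) p853044 (this seat): `map_mem_span_pow_iff`, `level_map_iff`; brings ★ F3-1a `GluedOverOrders` (`exists_map_rep_of_sub_mem_span`) and ★ F3-3 FILE 1 (`map_mem_span_pow_of_mem_span_pow`)
import HarnessLib

/-!
# Hermitian character classes descend to the fixed ring: `#{c′ mod ϖ^b hermitian, P} = #{y mod ϖ_F^b, P(ιO y)}`

Topic `NumberTheory/Automorphic`; namespace `Literature.NumberTheory.Automorphic`.  THEOREMS ONLY (no definition, no instance, no notation, no named fact, no `sorry`).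
Cell `pub/hodgecm-mathlib` (D-0151), crux H413 = `stmt-HodgeConjecture-24833`; road M6 → F3 «TOT-Λ by over-orders», step (S7): after ★ F3-2b's partition and (c3)'s
exhaustion the total is a sum over glued orders `G(N″, b, c′)`, i.e. over triples `(N″, b, c′ mod ϖ^b)`; only the HERMITIAN classes (`σO c′ ≡ c′`) contribute, and ★ (S7b)
counts classes of `𝒪_F` modulo `ϖ_F^b`.  The unramified dictionary `ιO : 𝒪_F → 𝒪_E` (`σO ∘ ιO = ιO`, `σO`-fixed elements come from `𝒪_F`, `ιO ϖ_F = ϖ`, `ιO` injective, a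
trace-one element `b₀ + σO b₀ = 1`) identifies the two: `y mod ϖ_F^b ↦ ιO y mod ϖ^b` is a bijection from the classes of `𝒪_F` onto the hermitian classes of `𝒪_E` (injective by
★ (ii) `map_mem_span_pow_iff`; onto by ★ F3-1a (S4) `exists_map_rep_of_sub_mem_span`, additive Hilbert 90 — 2-free), compatible with any class function `P`.

* §1 `natCard_hermitianClasses_eq_natCard_classes` — for every predicate `P` on `𝒪_E` constant on classes mod `ϖ^b`:
  `Nat.card {w : 𝒪_E⧸(ϖ^b) // ∃ c′, mk c′ = w ∧ σO c′ − c′ ∈ (ϖ^b) ∧ P c′} = Nat.card {w : 𝒪_F⧸(ϖ_F^b) // ∃ y, mk y = w ∧ P (ιO y)}`.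
* §2 `natCard_hermitianLevelClasses_eq_natCard_levelChars` — the instance F3-5 needs: `P c′ := (b = 0 ∨ Lvl_E(N″, b, c′)) ∧ ϖ^{N−N″}·c′ − ιO c ∈ (ϖ^b)` on the left becomes
  ★ (S7b)'s `levelChars` predicate `(b = 0 ∨ Lvl_F(N″, b, y)) ∧ ϖ_F^{N−N″}·y − c ∈ (ϖ_F^b)` on the right (★ (ii) `level_map_iff`, `map_mem_span_pow_iff`).

References: [SerreLocalFields1979] J.-P. Serre, *Local Fields*, GTM 67 (1979), Ch. X §1 (additive Hilbert 90), Ch. I §6; [Neukirch1999] J. Neukirch, *Algebraic Number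
Theory*, Grundlehren 322 (1999), Ch. I §12 (conductors of orders); [Rogawski1990] J. Rogawski, *Automorphic representations of unitary groups in three variables*, §4.9
Lemma 4.9.3 p. 56 («digits in `𝔽_q`»: the hermitian characters are counted over the fixed field).
-/

set_option autoImplicit false

noncomputable section

open scoped ValuativeRel
open ValuativeRel

namespace Literature.NumberTheory.Automorphic

variable {F E : Type*} [Field F] [ValuativeRel F] [Field E] [ValuativeRel E] (ιO : 𝒪[F] →+* 𝒪[E]) (σO : 𝒪[E] →+* 𝒪[E])

/-! ## §1 The class bijection -/

/-- **HERMITIAN CLASSES = CLASSES OF THE FIXED RING.**  For `b : ℕ` and a predicate `P` on `𝒪_E` constant on classes modulo `ϖ^b`: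
`#{w ∈ 𝒪_E⧸(ϖ^b) | ∃ c′ ↦ w, σO c′ ≡ c′ (ϖ^b), P c′} = #{w ∈ 𝒪_F⧸(ϖ_F^b) | ∃ y ↦ w, P (ιO y)}` — the map `y ↦ ιO y` on classes is injective (★ `map_mem_span_pow_iff`)
and reaches every hermitian class (★ `exists_map_rep_of_sub_mem_span`, additive Hilbert 90 with the trace-one element; no `½`). [cite: SerreLocalFields1979, Ch. X §1]
[cite: Rogawski1990, §4.9 Lemma 4.9.3 p. 56] -/
theorem natCard_hermitianClasses_eq_natCard_classes (hσσ : ∀ x, σO (σO x) = x) (hσι : ∀ y, σO (ιO y) = ιO y)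
    (hfixO : ∀ x, σO x = x → ∃ y, ιO y = x) (hιinj : Function.Injective ιO) (htr : ∃ b₀ : 𝒪[E], b₀ + σO b₀ = 1)
    {ϖF : F} {ϖ : E} (hϖF : IsUniformizingElement ϖF) (hϖ : IsUniformizingElement ϖ) (hιϖ : ιO ⟨ϖF, hϖF.mem⟩ = ⟨ϖ, hϖ.mem⟩)
    (b : ℕ) (P : 𝒪[E] → Prop) (hP : ∀ c c' : 𝒪[E], c - c' ∈ Ideal.span ({(⟨ϖ, hϖ.mem⟩ : 𝒪[E]) ^ b} : Set 𝒪[E]) → (P c ↔ P c')) :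
    Nat.card {w : 𝒪[E] ⧸ Ideal.span ({(⟨ϖ, hϖ.mem⟩ : 𝒪[E]) ^ b} : Set 𝒪[E]) //
        ∃ c' : 𝒪[E], Ideal.Quotient.mk _ c' = w ∧ σO c' - c' ∈ Ideal.span ({(⟨ϖ, hϖ.mem⟩ : 𝒪[E]) ^ b} : Set 𝒪[E]) ∧ P c'} =
      Nat.card {w : 𝒪[F] ⧸ Ideal.span ({(⟨ϖF, hϖF.mem⟩ : 𝒪[F]) ^ b} : Set 𝒪[F]) // ∃ y : 𝒪[F], Ideal.Quotient.mk _ y = w ∧ P (ιO y)} := by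
  classical
  set IE : Ideal 𝒪[E] := Ideal.span ({(⟨ϖ, hϖ.mem⟩ : 𝒪[E]) ^ b} : Set 𝒪[E]) with hIE
  set IF : Ideal 𝒪[F] := Ideal.span ({(⟨ϖF, hϖF.mem⟩ : 𝒪[F]) ^ b} : Set 𝒪[F]) with hIF
  -- the class map `𝒪_F⧸IF → 𝒪_E⧸IE` induced by `ιO`
  have hIFE : ∀ y : 𝒪[F], y ∈ IF → ιO y ∈ IE := fun y hy => map_mem_span_pow_of_mem_span_pow ιO hϖF hϖ hιϖ hy
  have hwd : ∀ y y' : 𝒪[F], Ideal.Quotient.mk IF y = Ideal.Quotient.mk IF y' → Ideal.Quotient.mk IE (ιO y) = Ideal.Quotient.mk IE (ιO y') := by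
    intro y y' h
    rw [Ideal.Quotient.eq] at h ⊢
    rw [← map_sub]; exact hIFE _ h
  have hinj : ∀ y y' : 𝒪[F], Ideal.Quotient.mk IE (ιO y) = Ideal.Quotient.mk IE (ιO y') → Ideal.Quotient.mk IF y = Ideal.Quotient.mk IF y' := by
    intro y y' h
    rw [Ideal.Quotient.eq] at h ⊢
    rw [← map_sub] at h
    exact (map_mem_span_pow_iff ιO σO hσι hfixO hιinj hϖF hϖ hιϖ _ b).1 h
  symm
  refine Nat.card_congr (Equiv.ofBijective
    (fun w => ⟨Ideal.Quotient.mk IE (ιO w.2.choose), ιO w.2.choose, rfl, by rw [hσι, sub_self]; exact IE.zero_mem, w.2.choose_spec.2⟩) ⟨?_, ?_⟩)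
  · -- injective
    rintro ⟨w, hw⟩ ⟨w', hw'⟩ h
    have h' : Ideal.Quotient.mk IE (ιO hw.choose) = Ideal.Quotient.mk IE (ιO hw'.choose) := congrArg Subtype.val h
    apply Subtype.ext
    change w = w'
    rw [← hw.choose_spec.1, ← hw'.choose_spec.1]
    exact hinj _ _ h'
  · -- surjective: a hermitian class has a representative `ιO y`
    rintro ⟨w, c', hc'w, hherm, hPc'⟩
    obtain ⟨y, hy⟩ := exists_map_rep_of_sub_mem_span ((⟨ϖ, hϖ.mem⟩ : 𝒪[E]) ^ b) σO hσσ ιO hfixO htr (b := 1)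
      (c' := c') (by rw [pow_one]; exact hherm)
    rw [pow_one] at hy
    have hyP : P (ιO y) := (hP _ _ hy).2 hPc'
    refine ⟨⟨Ideal.Quotient.mk IF y, y, rfl, hyP⟩, ?_⟩
    apply Subtype.ext
    change Ideal.Quotient.mk IE (ιO (⟨y, rfl, hyP⟩ : ∃ y' : 𝒪[F], Ideal.Quotient.mk IF y' = Ideal.Quotient.mk IF y ∧ P (ιO y')).choose) = w
    have hch := (⟨y, rfl, hyP⟩ : ∃ y' : 𝒪[F], Ideal.Quotient.mk IF y' = Ideal.Quotient.mk IF y ∧ P (ιO y')).choose_spec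
    rw [hwd _ _ hch.1, ← hc'w, Ideal.Quotient.eq]
    exact hy

/-! ## §2 The instance for ★ (S7b)'s `levelChars` -/

/-- **THE HERMITIAN LEVEL CLASSES OF `𝒪_E` ARE ★ (S7b)'s `levelChars` OF `𝒪_F`.**  With the unramified dictionary as in §1 and a reference character value `c ∈ 𝒪_F`
(the `ιO y₀` of (c6) «R is glued»): the number of classes `c′ mod ϖ^b` of `𝒪_E` that are HERMITIAN, at a MONOGENIC LEVEL (`b = 0 ∨ Lvl_E(N″, b, c′)`, ★ (ii)'s tokens) and
COMPATIBLE (`ϖ^{N−N″}c′ ≡ ιO c (ϖ^b)`) equals the number of classes `y mod ϖ_F^b` of `𝒪_F` with `(b = 0 ∨ Lvl_F(N″, b, y)) ∧ ϖ_F^{N−N″}y ≡ c (ϖ_F^b)` — ★ (S7b)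
`natCard_levelChars_zero ∕ _odd ∕ _even`'s subtype, token for token. [cite: Rogawski1990, §4.9 Lemma 4.9.3 p. 56] [cite: SerreLocalFields1979, Ch. X §1] -/
theorem natCard_hermitianLevelClasses_eq_natCard_levelChars (hσσ : ∀ x, σO (σO x) = x) (hσι : ∀ y, σO (ιO y) = ιO y)
    (hfixO : ∀ x, σO x = x → ∃ y, ιO y = x) (hιinj : Function.Injective ιO) (htr : ∃ b₀ : 𝒪[E], b₀ + σO b₀ = 1)
    {ϖF : F} {ϖ : E} (hϖF : IsUniformizingElement ϖF) (hϖ : IsUniformizingElement ϖ) (hιϖ : ιO ⟨ϖF, hϖF.mem⟩ = ⟨ϖ, hϖ.mem⟩)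
    (N N'' b : ℕ) (c : 𝒪[F]) :
    Nat.card {w : 𝒪[E] ⧸ Ideal.span ({(⟨ϖ, hϖ.mem⟩ : 𝒪[E]) ^ b} : Set 𝒪[E]) //
        ∃ c' : 𝒪[E], Ideal.Quotient.mk _ c' = w ∧ σO c' - c' ∈ Ideal.span ({(⟨ϖ, hϖ.mem⟩ : 𝒪[E]) ^ b} : Set 𝒪[E]) ∧
          ((b = 0 ∨ (b = 2 * N'' + 1 ∧ c' ∈ Ideal.span ({(⟨ϖ, hϖ.mem⟩ : 𝒪[E]) ^ (N'' + 1)} : Set 𝒪[E])) ∨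
              ∃ M : ℕ, 1 ≤ M ∧ M ≤ N'' ∧ b = 2 * M ∧ c' ∈ Ideal.span ({(⟨ϖ, hϖ.mem⟩ : 𝒪[E]) ^ M} : Set 𝒪[E]) ∧
                c' ∉ Ideal.span ({(⟨ϖ, hϖ.mem⟩ : 𝒪[E]) ^ (M + 1)} : Set 𝒪[E])) ∧
            (⟨ϖ, hϖ.mem⟩ : 𝒪[E]) ^ (N - N'') * c' - ιO c ∈ Ideal.span ({(⟨ϖ, hϖ.mem⟩ : 𝒪[E]) ^ b} : Set 𝒪[E]))} =
      Nat.card {w : 𝒪[F] ⧸ Ideal.span ({(⟨ϖF, hϖF.mem⟩ : 𝒪[F]) ^ b} : Set 𝒪[F]) //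
        ∃ y : 𝒪[F], Ideal.Quotient.mk _ y = w ∧
          ((b = 0 ∨ (b = 2 * N'' + 1 ∧ y ∈ Ideal.span ({(⟨ϖF, hϖF.mem⟩ : 𝒪[F]) ^ (N'' + 1)} : Set 𝒪[F])) ∨
              ∃ M : ℕ, 1 ≤ M ∧ M ≤ N'' ∧ b = 2 * M ∧ y ∈ Ideal.span ({(⟨ϖF, hϖF.mem⟩ : 𝒪[F]) ^ M} : Set 𝒪[F]) ∧
                y ∉ Ideal.span ({(⟨ϖF, hϖF.mem⟩ : 𝒪[F]) ^ (M + 1)} : Set 𝒪[F])) ∧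
            (⟨ϖF, hϖF.mem⟩ : 𝒪[F]) ^ (N - N'') * y - c ∈ Ideal.span ({(⟨ϖF, hϖF.mem⟩ : 𝒪[F]) ^ b} : Set 𝒪[F]))} := by
  set π : 𝒪[E] := ⟨ϖ, hϖ.mem⟩ with hπ
  set πF : 𝒪[F] := ⟨ϖF, hϖF.mem⟩ with hπF
  -- the level-and-compatibility predicate is a class function mod `π^b`
  have hmemiff : ∀ (c₁ c₂ : 𝒪[E]) (m : ℕ), m ≤ b → c₁ - c₂ ∈ Ideal.span ({π ^ b} : Set 𝒪[E]) →
      (c₁ ∈ Ideal.span ({π ^ m} : Set 𝒪[E]) ↔ c₂ ∈ Ideal.span ({π ^ m} : Set 𝒪[E])) := by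
    intro c₁ c₂ m hm h
    have h' : c₁ - c₂ ∈ Ideal.span ({π ^ m} : Set 𝒪[E]) := Ideal.span_singleton_le_span_singleton.2 (pow_dvd_pow π hm) h
    constructor
    · intro h1; simpa using Ideal.sub_mem _ h1 h'
    · intro h2; simpa using Ideal.add_mem _ h2 h'
  refine (natCard_hermitianClasses_eq_natCard_classes ιO σO hσσ hσι hfixO hιinj htr hϖF hϖ hιϖ b _ ?_).trans ?_
  · -- the level-and-compatibility predicate is a class function mod `π^b`
    intro c₁ c₂ h
    have hcomp : π ^ (N - N'') * c₁ - ιO c ∈ Ideal.span ({π ^ b} : Set 𝒪[E]) ↔ π ^ (N - N'') * c₂ - ιO c ∈ Ideal.span ({π ^ b} : Set 𝒪[E]) := by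
      have hd : (π ^ (N - N'') * c₁ - ιO c) - (π ^ (N - N'') * c₂ - ιO c) ∈ Ideal.span ({π ^ b} : Set 𝒪[E]) := by
        have : (π ^ (N - N'') * c₁ - ιO c) - (π ^ (N - N'') * c₂ - ιO c) = π ^ (N - N'') * (c₁ - c₂) := by ring
        rw [this]; exact Ideal.mul_mem_left _ _ h
      constructor
      · intro h1; simpa using Ideal.sub_mem _ h1 hd
      · intro h2; simpa using Ideal.add_mem _ h2 hd
    refine and_congr (or_congr Iff.rfl (or_congr ?_ (exists_congr fun M => ?_))) hcomp
    · constructor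
      · rintro ⟨hb, h1⟩; exact ⟨hb, (hmemiff c₁ c₂ (N'' + 1) (by omega) h).1 h1⟩
      · rintro ⟨hb, h2⟩; exact ⟨hb, (hmemiff c₁ c₂ (N'' + 1) (by omega) h).2 h2⟩
    · constructor
      · rintro ⟨hM1, hMN, hb, h1, h1'⟩
        exact ⟨hM1, hMN, hb, (hmemiff c₁ c₂ M (by omega) h).1 h1, fun h2' => h1' ((hmemiff c₁ c₂ (M + 1) (by omega) h).2 h2')⟩
      · rintro ⟨hM1, hMN, hb, h2, h2'⟩
        exact ⟨hM1, hMN, hb, (hmemiff c₁ c₂ M (by omega) h).2 h2, fun h1' => h2' ((hmemiff c₁ c₂ (M + 1) (by omega) h).1 h1')⟩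
  · -- read the predicate at `ιO y` in `𝒪_F`
    refine Nat.card_congr (Equiv.subtypeEquivRight fun w => exists_congr fun y => and_congr Iff.rfl ?_)
    have hcompat : π ^ (N - N'') * ιO y - ιO c ∈ Ideal.span ({π ^ b} : Set 𝒪[E]) ↔ πF ^ (N - N'') * y - c ∈ Ideal.span ({πF ^ b} : Set 𝒪[F]) := by
      have h : π ^ (N - N'') * ιO y - ιO c = ιO (πF ^ (N - N'') * y - c) := by rw [map_sub, map_mul, map_pow, hιϖ]
      rw [h]
      exact map_mem_span_pow_iff ιO σO hσι hfixO hιinj hϖF hϖ hιϖ _ b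
    exact and_congr (or_congr Iff.rfl (level_map_iff ιO σO hσι hfixO hιinj hϖF hϖ hιϖ y N'' b)) hcompat

end Literature.NumberTheory.Automorphic

end
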